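import Mathlib
import HarnessLib
import Summits.AtomisticToContinuum.FouriersLaw.Theses.JunctionLocality
import Summits.AtomisticToContinuum.FouriersLaw.Theorems.JunctionLocalitySuperadditiveResistanceKuboKernel

/-!
# Kubo–Onsager structure for RESOLVENT fields (λ-frame of line `floating-probe-bypass-laplacian`,
# crux stmt-AtomisticToContinuum-11748)

The pair toolkit (`…Kubo{Cutoff,…,Kernel}`) is stated for exact pairs `σ X_H f + c S_B f = −k`. A RESOLVENT field
`(κ − L) f = k`, i.e. `σ X_H f + c S_B f = −(k − κ f)` (`κ ≥ 0`), is an exact pair with the shifted source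
`k' = k − κ f ∈ L²(μ_T)`, so every identity of the toolkit applies verbatim; this file records what they give for
the original source `k`:

* `resolvent_fd` — `∫ f k ρ = κ ∫ f² ρ + c T Σ_i B_i ∫ (∂_{p_i} f)² ρ` (fluctuation–dissipation with a mass term);
* `resolvent_pairing` — for a `σ`-resolvent pair `(f, k_f, κ_f)` and a `σ`-resolvent pair `(h, k_h, κ_h)` with EVEN
  sources: `∫ h k_f ρ = ∫ f k_h ρ + (κ_f − κ_h) ∫ f (rev h) ρ`; equal masses give ONSAGER SYMMETRY
  (`resolvent_symmetry`), and `h = H` (mass `0`, source `c Σ_i B_i (p_i² − T)`) gives the SUM RULE WITH DEFECT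
  `Σ_b ∫ g_a (p_{s_b}² − T) ρ = T²/c ∫ρ − (κ/c) ∫ g_a H ρ` (`resolvent_sum_kuboPair`);
* `resolvent_comb_kinetic_le` — completion of the square with the mass term: `∫ g_θ k_θ ρ ≤ (T²/c)|θ|² ∫ρ`
  and `κ ∫ g_θ² ρ ≤ (T²/c)|θ|² ∫ρ`;
* `kubo_onsager_resolvent` — for a terminal frame of `κ`-resolvent fields the matrix
  `K_ab = c δ_ab − (c²/T²) ∫ g_a (p_{s_b}² − T) dμ_T` is SYMMETRIC, POSITIVE SEMIDEFINITE, and its row sums are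
  `Σ_b K_ab = (c κ / T²) ∫ g_a H dμ_T` with `κ ∫ g_a² dμ_T ≤ T²/c` — an Onsager Laplacian up to `O(√κ)` row sums.

Purpose: resolvent device fields exist unconditionally for every `κ > 0` (essential m-dissipativity), so a line stated
in the `κ → 0⁺` frame needs no `κ = 0` solvability (no 4-bath semigroup theory). Standard axioms only. -/

noncomputable section

open MeasureTheory Filter Topology ProbabilityTheory
open scoped ContDiff
open Literature.MathematicalPhysics.KineticTheory.HeatConduction
open Summit.AtomisticToContinuum.FouriersLaw.Theorems.SuperadditiveResistance.DeviceLiouville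

namespace Summit.AtomisticToContinuum.FouriersLaw.Theorems.SuperadditiveResistance.Kubo

section Resolvent

variable {ω₂ lam β γ : ℝ} {L m : ℕ}

/-- **Fluctuation–dissipation with a mass term**: for `σ X_H f + c S_B f = −(k − κ f)`,
`∫ f k ρ = κ ∫ f² ρ + c T Σ_i B_i ∫ (∂_{p_i} f)² ρ`. [folklore] -/
theorem resolvent_fd (hω : 0 < ω₂) (hl : 0 ≤ lam) (hβ : 0 ≤ β) (L : ℕ) {T : ℝ} (hT : 0 < T)
    (B : Fin L → ℝ) (hB : ∀ i, 0 ≤ B i) (σ : ℝ) {c : ℝ} (hc : 0 < c) (κ : ℝ) {f k : PhaseSpace L → ℝ}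
    (hf : ContDiff ℝ 2 f) (hf2 : MemLp f 2 ((pinnedChain ω₂ lam β γ).gibbsMeasure L T)) (hk2 : MemLp k 2 ((pinnedChain ω₂ lam β γ).gibbsMeasure L T))
    (hpde : ∀ x, σ * liouvilleOp (pinnedChain ω₂ lam β γ) L f x + c * bathOp L B T f x = -(k x - κ * f x)) :
    ∫ x, f x * k x * (pinnedChain ω₂ lam β γ).gibbsDensity L T x =
      κ * (∫ x, f x ^ 2 * (pinnedChain ω₂ lam β γ).gibbsDensity L T x) +
        c * T * ∑ i, B i * ∫ x, partialP i f x ^ 2 * (pinnedChain ω₂ lam β γ).gibbsDensity L T x := by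
  have hk' : MemLp (fun x => k x - κ * f x) 2 ((pinnedChain ω₂ lam β γ).gibbsMeasure L T) := hk2.sub (hf2.const_mul κ)
  have h := fluctuation_dissipation hω hl hβ L hT B hB σ hc hf hf2 hk' hpde
  have hI1 := integrable_mul_mul_gibbsDensity hω hl hβ γ L hT hf2 hk2
  have hI2 := integrable_mul_mul_gibbsDensity hω hl hβ γ L hT hf2 hf2
  have e : (fun x => f x * (k x - κ * f x) * (pinnedChain ω₂ lam β γ).gibbsDensity L T x) =
      fun x => f x * k x * (pinnedChain ω₂ lam β γ).gibbsDensity L T x - κ * (f x * f x * (pinnedChain ω₂ lam β γ).gibbsDensity L T x) := by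
    funext x; ring
  rw [e, integral_sub hI1 (hI2.const_mul κ), integral_const_mul] at h
  have e2 : ∫ x, f x ^ 2 * (pinnedChain ω₂ lam β γ).gibbsDensity L T x = ∫ x, f x * f x * (pinnedChain ω₂ lam β γ).gibbsDensity L T x :=
    integral_congr_ae (ae_of_all _ fun x => by ring)
  rw [e2]
  linarith

/-- **Resolvent pairing identity.** For a `σ`-resolvent pair `(f, k_f)` of mass `κ_f` and a `σ`-resolvent pair
`(h, k_h)` of mass `κ_h`, both with even sources: `∫ h k_f ρ = ∫ f k_h ρ + (κ_f − κ_h) ∫ f (rev h) ρ`.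
(Cross Green identity applied to `f` and the reversed field `rev h`.) [folklore] -/
theorem resolvent_pairing (hω : 0 < ω₂) (hl : 0 ≤ lam) (hβ : 0 ≤ β) (L : ℕ) {T : ℝ} (hT : 0 < T)
    (B : Fin L → ℝ) (hB : ∀ i, 0 ≤ B i) (σ : ℝ) {c : ℝ} (hc : 0 < c) (κf κh : ℝ)
    {f kf h kh : PhaseSpace L → ℝ} (hf : ContDiff ℝ 2 f) (hh : ContDiff ℝ 2 h)
    (hf2 : MemLp f 2 ((pinnedChain ω₂ lam β γ).gibbsMeasure L T)) (hh2 : MemLp h 2 ((pinnedChain ω₂ lam β γ).gibbsMeasure L T))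
    (hkf2 : MemLp kf 2 ((pinnedChain ω₂ lam β γ).gibbsMeasure L T)) (hkh2 : MemLp kh 2 ((pinnedChain ω₂ lam β γ).gibbsMeasure L T))
    (hkf_even : rev kf = kf) (hkh_even : rev kh = kh)
    (hpf : ∀ x, σ * liouvilleOp (pinnedChain ω₂ lam β γ) L f x + c * bathOp L B T f x = -(kf x - κf * f x))
    (hph : ∀ x, σ * liouvilleOp (pinnedChain ω₂ lam β γ) L h x + c * bathOp L B T h x = -(kh x - κh * h x)) :
    ∫ x, h x * kf x * (pinnedChain ω₂ lam β γ).gibbsDensity L T x =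
      (∫ x, f x * kh x * (pinnedChain ω₂ lam β γ).gibbsDensity L T x) + (κf - κh) * ∫ x, f x * rev h x * (pinnedChain ω₂ lam β γ).gibbsDensity L T x := by
  have hrh : ContDiff ℝ 2 (rev h) := contDiff_rev hh
  have hrh2 : MemLp (rev h) 2 ((pinnedChain ω₂ lam β γ).gibbsMeasure L T) := memLp_rev hω hl hβ L hT hh.continuous hh2
  have hkh_pt : ∀ x : PhaseSpace L, kh (x.1, -x.2) = kh x := fun x => congr_fun hkh_even x
  have hkf_pt : ∀ x : PhaseSpace L, kf (x.1, -x.2) = kf x := fun x => congr_fun hkf_even x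
  -- rev h is a (−σ)-pair with source kh − κh · rev h
  have hph' : ∀ x, -σ * liouvilleOp (pinnedChain ω₂ lam β γ) L (rev h) x + c * bathOp L B T (rev h) x = -(kh x - κh * rev h x) := by
    intro x
    have h1 := rev_pair (pinnedChain ω₂ lam β γ) B T σ c (f := h) (k := fun y => kh y - κh * h y) hph x
    rw [h1]
    simp only [rev_apply, hkh_pt]
  have hkf' : MemLp (fun x => kf x - κf * f x) 2 ((pinnedChain ω₂ lam β γ).gibbsMeasure L T) := hkf2.sub (hf2.const_mul κf)
  have hkh' : MemLp (fun x => kh x - κh * rev h x) 2 ((pinnedChain ω₂ lam β γ).gibbsMeasure L T) := hkh2.sub (hrh2.const_mul κh)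
  have hcross := cross hω hl hβ L hT B hB σ hc hf hrh hf2 hrh2 hkf' hkh' hpf hph'
  have hI1 := integrable_mul_mul_gibbsDensity hω hl hβ γ L hT hrh2 hkf2
  have hI2 := integrable_mul_mul_gibbsDensity hω hl hβ γ L hT hrh2 hf2
  have hI3 := integrable_mul_mul_gibbsDensity hω hl hβ γ L hT hf2 hkh2
  have hI4 := integrable_mul_mul_gibbsDensity hω hl hβ γ L hT hf2 hrh2
  have e1 : (fun x => rev h x * (kf x - κf * f x) * (pinnedChain ω₂ lam β γ).gibbsDensity L T x) =
      fun x => rev h x * kf x * (pinnedChain ω₂ lam β γ).gibbsDensity L T x - κf * (rev h x * f x * (pinnedChain ω₂ lam β γ).gibbsDensity L T x) := by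
    funext x; ring
  have e2 : (fun x => f x * (kh x - κh * rev h x) * (pinnedChain ω₂ lam β γ).gibbsDensity L T x) =
      fun x => f x * kh x * (pinnedChain ω₂ lam β γ).gibbsDensity L T x - κh * (f x * rev h x * (pinnedChain ω₂ lam β γ).gibbsDensity L T x) := by
    funext x; ring
  rw [e1, e2, integral_sub hI1 (hI2.const_mul κf), integral_sub hI3 (hI4.const_mul κh), integral_const_mul,
    integral_const_mul] at hcross
  rw [show ∫ x, rev h x * f x * (pinnedChain ω₂ lam β γ).gibbsDensity L T x = ∫ x, f x * rev h x * (pinnedChain ω₂ lam β γ).gibbsDensity L T x from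
    integral_congr_ae (ae_of_all _ fun x => by ring)] at hcross
  have e4 : ∫ x, rev h x * kf x * (pinnedChain ω₂ lam β γ).gibbsDensity L T x = ∫ x, h x * kf x * (pinnedChain ω₂ lam β γ).gibbsDensity L T x := by
    have e : (fun x => rev h x * kf x * (pinnedChain ω₂ lam β γ).gibbsDensity L T x) =
        fun x => rev (fun y => h y * kf y) x * (pinnedChain ω₂ lam β γ).gibbsDensity L T x := by
      funext x
      simp only [rev_apply, hkf_pt]
    rw [e, integral_rev_mul_gibbsDensity]
  linarith

/-- **Onsager symmetry for resolvent fields of equal mass** (even sources). [folklore] -/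
theorem resolvent_symmetry (hω : 0 < ω₂) (hl : 0 ≤ lam) (hβ : 0 ≤ β) (L : ℕ) {T : ℝ} (hT : 0 < T)
    (B : Fin L → ℝ) (hB : ∀ i, 0 ≤ B i) (σ : ℝ) {c : ℝ} (hc : 0 < c) (κ : ℝ)
    {f kf h kh : PhaseSpace L → ℝ} (hf : ContDiff ℝ 2 f) (hh : ContDiff ℝ 2 h)
    (hf2 : MemLp f 2 ((pinnedChain ω₂ lam β γ).gibbsMeasure L T)) (hh2 : MemLp h 2 ((pinnedChain ω₂ lam β γ).gibbsMeasure L T))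
    (hkf2 : MemLp kf 2 ((pinnedChain ω₂ lam β γ).gibbsMeasure L T)) (hkh2 : MemLp kh 2 ((pinnedChain ω₂ lam β γ).gibbsMeasure L T))
    (hkf_even : rev kf = kf) (hkh_even : rev kh = kh)
    (hpf : ∀ x, σ * liouvilleOp (pinnedChain ω₂ lam β γ) L f x + c * bathOp L B T f x = -(kf x - κ * f x))
    (hph : ∀ x, σ * liouvilleOp (pinnedChain ω₂ lam β γ) L h x + c * bathOp L B T h x = -(kh x - κ * h x)) :
    ∫ x, h x * kf x * (pinnedChain ω₂ lam β γ).gibbsDensity L T x = ∫ x, f x * kh x * (pinnedChain ω₂ lam β γ).gibbsDensity L T x := by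
  have h := resolvent_pairing hω hl hβ L hT B hB σ hc κ κ hf hh hf2 hh2 hkf2 hkh2 hkf_even hkh_even hpf hph
  simpa using h

/-- **Onsager reciprocity in a terminal frame of resolvent fields.** [folklore] -/
theorem resolvent_kuboPair_symm (hω : 0 < ω₂) (hl : 0 ≤ lam) (hβ : 0 ≤ β) (L : ℕ) {T : ℝ} (hT : 0 < T)
    (s : Fin m → Fin L) (σ : ℝ) {c : ℝ} (hc : 0 < c) (κ : ℝ)
    {g : Fin m → PhaseSpace L → ℝ} (hg : ∀ a, ContDiff ℝ 2 (g a)) (hgL : ∀ a, MemLp (g a) 2 ((pinnedChain ω₂ lam β γ).gibbsMeasure L T))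
    (hpde : ∀ a x, σ * liouvilleOp (pinnedChain ω₂ lam β γ) L (g a) x + c * bathOp L (termWeight s) T (g a) x =
      -((x.2 (s a) ^ 2 - T) - κ * g a x)) (a b : Fin m) :
    ∫ x, g a x * (x.2 (s b) ^ 2 - T) * (pinnedChain ω₂ lam β γ).gibbsDensity L T x =
      ∫ x, g b x * (x.2 (s a) ^ 2 - T) * (pinnedChain ω₂ lam β γ).gibbsDensity L T x :=
  resolvent_symmetry hω hl hβ L hT (termWeight s) (termWeight_nonneg s) σ hc κ (hg b) (hg a) (hgL b) (hgL a)
    (memLp_kinetic hω hl hβ L hT (s b)) (memLp_kinetic hω hl hβ L hT (s a)) (rev_kinetic (s b) T)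
    (rev_kinetic (s a) T) (hpde b) (hpde a)

/-- **Sum rule with defect**: in a terminal frame of `κ`-resolvent fields,
`Σ_b ∫ g_a (p_{s_b}² − T) ρ = (T²/c) ∫ ρ − (κ/c) ∫ g_a H ρ`. [folklore] -/
theorem resolvent_sum_kuboPair (hω : 0 < ω₂) (hl : 0 ≤ lam) (hβ : 0 ≤ β) (L : ℕ) {T : ℝ} (hT : 0 < T)
    (s : Fin m → Fin L) (σ : ℝ) {c : ℝ} (hc : 0 < c) (κ : ℝ)
    {g : Fin m → PhaseSpace L → ℝ} (hg : ∀ a, ContDiff ℝ 2 (g a)) (hgL : ∀ a, MemLp (g a) 2 ((pinnedChain ω₂ lam β γ).gibbsMeasure L T))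
    (hpde : ∀ a x, σ * liouvilleOp (pinnedChain ω₂ lam β γ) L (g a) x + c * bathOp L (termWeight s) T (g a) x =
      -((x.2 (s a) ^ 2 - T) - κ * g a x)) (a : Fin m) :
    ∑ b, ∫ x, g a x * (x.2 (s b) ^ 2 - T) * (pinnedChain ω₂ lam β γ).gibbsDensity L T x =
      T ^ 2 / c * (∫ x, (pinnedChain ω₂ lam β γ).gibbsDensity L T x) -
        κ / c * ∫ x, g a x * (pinnedChain ω₂ lam β γ).hamiltonian L x * (pinnedChain ω₂ lam β γ).gibbsDensity L T x := by
  have hU : ContDiff ℝ ∞ (pinnedChain ω₂ lam β γ).U := pinnedChain_contDiff_U ω₂ lam β γ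
  have hV : ContDiff ℝ ∞ (pinnedChain ω₂ lam β γ).V := pinnedChain_contDiff_V ω₂ lam β γ
  have hH2 : ContDiff ℝ 2 ((pinnedChain ω₂ lam β γ).hamiltonian L) := ((pinnedChain ω₂ lam β γ).contDiff_hamiltonian hU hV L).of_le (by norm_cast)
  set KH : PhaseSpace L → ℝ := fun x => c * ∑ i, termWeight s i * (x.2 i ^ 2 - T) with hKH
  -- H is an exact pair (mass 0) for the total heating
  have hHpde : ∀ x, σ * liouvilleOp (pinnedChain ω₂ lam β γ) L ((pinnedChain ω₂ lam β γ).hamiltonian L) x + c * bathOp L (termWeight s) T ((pinnedChain ω₂ lam β γ).hamiltonian L) x =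
      -(KH x - 0 * (pinnedChain ω₂ lam β γ).hamiltonian L x) := fun x => by
    rw [zero_mul, sub_zero]; exact hamiltonian_pair (pinnedChain ω₂ lam β γ) (termWeight s) T σ c x
  have hKH_even : rev KH = KH := by funext y; simp [rev, hKH]
  have hKH2 : MemLp KH 2 ((pinnedChain ω₂ lam β γ).gibbsMeasure L T) := by
    have : MemLp (fun x => ∑ i, termWeight s i * (x.2 i ^ 2 - T)) 2 ((pinnedChain ω₂ lam β γ).gibbsMeasure L T) :=
      memLp_finsetSum _ fun i _ => (memLp_kinetic hω hl hβ L hT i).const_mul _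
    exact this.const_mul c
  have hHeven : rev ((pinnedChain ω₂ lam β γ).hamiltonian L) = (pinnedChain ω₂ lam β γ).hamiltonian L := by
    funext y; simp [rev, OscillatorChain.hamiltonian_neg_momentum]
  -- pairing identity between (g a, p_{s a}² − T, κ) and (H, KH, 0)
  have hpair := resolvent_pairing hω hl hβ L hT (termWeight s) (termWeight_nonneg s) σ hc κ 0 (hg a) hH2 (hgL a)
    (memLp_hamiltonian hω hl hβ L hT) (memLp_kinetic hω hl hβ L hT (s a)) hKH2 (rev_kinetic (s a) T) hKH_even
    (hpde a) hHpde
  -- hpair : ∫ H (p_{s a}² − T) ρ = ∫ g_a KH ρ + (κ − 0) ∫ g_a (rev H) ρ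
  rw [hHeven, sub_zero] at hpair
  have hLHS : ∫ x, (pinnedChain ω₂ lam β γ).hamiltonian L x * (x.2 (s a) ^ 2 - T) * (pinnedChain ω₂ lam β γ).gibbsDensity L T x =
      T ^ 2 * ∫ x, (pinnedChain ω₂ lam β γ).gibbsDensity L T x := by
    rw [← integral_kinetic_mul_hamiltonian_mul_gibbsDensity hω hl hβ L hT (s a)]
    exact integral_congr_ae (ae_of_all _ fun x => by ring)
  have hI : ∀ i, Integrable fun x => g a x * (x.2 i ^ 2 - T) * (pinnedChain ω₂ lam β γ).gibbsDensity L T x := fun i =>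
    integrable_mul_mul_gibbsDensity hω hl hβ γ L hT (hgL a) (memLp_kinetic hω hl hβ L hT i)
  have hRHS : ∫ x, g a x * KH x * (pinnedChain ω₂ lam β γ).gibbsDensity L T x =
      c * ∑ b, ∫ x, g a x * (x.2 (s b) ^ 2 - T) * (pinnedChain ω₂ lam β γ).gibbsDensity L T x := by
    have hpt : (fun x => g a x * KH x * (pinnedChain ω₂ lam β γ).gibbsDensity L T x) =
        fun x => ∑ i, c * termWeight s i * (g a x * (x.2 i ^ 2 - T) * (pinnedChain ω₂ lam β γ).gibbsDensity L T x) := by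
      funext x
      simp only [hKH, Finset.mul_sum, Finset.sum_mul]
      refine Finset.sum_congr rfl fun i _ => ?_
      ring
    rw [hpt, integral_finsetSum _ fun i _ => (hI i).const_mul _]
    have e2 : ∀ i, ∫ x, c * termWeight s i * (g a x * (x.2 i ^ 2 - T) * (pinnedChain ω₂ lam β γ).gibbsDensity L T x) =
        c * (termWeight s i * ∫ x, g a x * (x.2 i ^ 2 - T) * (pinnedChain ω₂ lam β γ).gibbsDensity L T x) := fun i => by
      rw [integral_const_mul]; ring
    simp only [e2, ← Finset.mul_sum]
    rw [sum_termWeight_mul s fun i => ∫ x, g a x * (x.2 i ^ 2 - T) * (pinnedChain ω₂ lam β γ).gibbsDensity L T x]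
  rw [hLHS, hRHS] at hpair
  have hc0 : c ≠ 0 := hc.ne'
  field_simp
  linarith

/-- **Completion of the square with a mass term.** In a terminal frame of `κ`-resolvent fields with `κ ≥ 0`:
`0 ≤ ∫ g_θ k_θ ρ ≤ (T²/c)|θ|² ∫ ρ` and `κ ∫ g_θ² ρ ≤ (T²/c)|θ|² ∫ ρ`, where `k_θ = Σ_a θ_a (p_{s_a}² − T)`. [folklore] -/
theorem resolvent_comb_kinetic_le (hω : 0 < ω₂) (hl : 0 ≤ lam) (hβ : 0 ≤ β) (L : ℕ) {T : ℝ} (hT : 0 < T)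
    (s : Fin m → Fin L) (hs : Function.Injective s) (σ : ℝ) {c : ℝ} (hc : 0 < c) {κ : ℝ} (hκ : 0 ≤ κ)
    {g : Fin m → PhaseSpace L → ℝ} (hg : ∀ a, ContDiff ℝ 2 (g a)) (hgL : ∀ a, MemLp (g a) 2 ((pinnedChain ω₂ lam β γ).gibbsMeasure L T))
    (hpde : ∀ a x, σ * liouvilleOp (pinnedChain ω₂ lam β γ) L (g a) x + c * bathOp L (termWeight s) T (g a) x =
      -((x.2 (s a) ^ 2 - T) - κ * g a x))
    (θ : Fin m → ℝ) :
    (∫ x, comb θ g x * comb θ (fun a y => y.2 (s a) ^ 2 - T) x * (pinnedChain ω₂ lam β γ).gibbsDensity L T x ≤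
      T ^ 2 / c * (∑ a, θ a ^ 2) * ∫ x, (pinnedChain ω₂ lam β γ).gibbsDensity L T x) ∧
    (κ * ∫ x, comb θ g x ^ 2 * (pinnedChain ω₂ lam β γ).gibbsDensity L T x ≤
      T ^ 2 / c * (∑ a, θ a ^ 2) * ∫ x, (pinnedChain ω₂ lam β γ).gibbsDensity L T x) ∧
    (0 ≤ ∫ x, comb θ g x * comb θ (fun a y => y.2 (s a) ^ 2 - T) x * (pinnedChain ω₂ lam β γ).gibbsDensity L T x) := by
  set B := termWeight s with hBdef
  have hB0 : ∀ i, 0 ≤ B i := termWeight_nonneg s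
  have hBpos : ∀ a, 0 < B (s a) := termWeight_pos s hs
  set gθ := comb θ g with hgθdef
  set kθ : PhaseSpace L → ℝ := comb θ (fun a y => y.2 (s a) ^ 2 - T) with hkθdef
  have hgθ : ContDiff ℝ 2 gθ := contDiff_comb θ hg
  have hgθ1 : ContDiff ℝ 1 gθ := hgθ.of_le (by norm_cast)
  have hgθL : MemLp gθ 2 ((pinnedChain ω₂ lam β γ).gibbsMeasure L T) := memLp_comb θ hgL
  have hkθL : MemLp kθ 2 ((pinnedChain ω₂ lam β γ).gibbsMeasure L T) := memLp_comb θ fun a => memLp_kinetic hω hl hβ L hT (s a)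
  -- the combined field is a κ-resolvent field for the combined source
  have hpθ0 : ∀ x, σ * liouvilleOp (pinnedChain ω₂ lam β γ) L gθ x + c * bathOp L B T gθ x =
      -comb θ (fun a y => (y.2 (s a) ^ 2 - T) - κ * g a y) x :=
    comb_pair (pinnedChain ω₂ lam β γ) B T σ c θ hg hpde
  have hcomb : ∀ x, comb θ (fun a y => (y.2 (s a) ^ 2 - T) - κ * g a y) x = kθ x - κ * gθ x := by
    intro x
    simp only [hkθdef, hgθdef, comb_apply, Finset.mul_sum, ← Finset.sum_sub_distrib]
    refine Finset.sum_congr rfl fun a _ => ?_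
    ring
  have hpθ : ∀ x, σ * liouvilleOp (pinnedChain ω₂ lam β γ) L gθ x + c * bathOp L B T gθ x = -(kθ x - κ * gθ x) := fun x => by
    rw [hpθ0 x, hcomb x]
  have hk' : MemLp (fun x => kθ x - κ * gθ x) 2 ((pinnedChain ω₂ lam β γ).gibbsMeasure L T) := hkθL.sub (hgθL.const_mul κ)
  have hd2 : ∀ a, MemLp (partialP (s a) gθ) 2 ((pinnedChain ω₂ lam β γ).gibbsMeasure L T) := fun a =>
    memLp_partialP hω hl hβ γ L hT B hB0 σ hc hgθ hgθL hk' hpθ (hBpos a)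
  -- named quantities
  set Z : ℝ := ∫ x, (pinnedChain ω₂ lam β γ).gibbsDensity L T x with hZ
  set I : ℝ := ∫ x, gθ x * kθ x * (pinnedChain ω₂ lam β γ).gibbsDensity L T x with hI
  set G2 : ℝ := ∫ x, gθ x ^ 2 * (pinnedChain ω₂ lam β γ).gibbsDensity L T x with hG2
  set D : Fin m → ℝ := fun a => ∫ x, partialP (s a) gθ x ^ 2 * (pinnedChain ω₂ lam β γ).gibbsDensity L T x with hD
  set Pa : Fin m → ℝ := fun a => ∫ x, x.2 (s a) * partialP (s a) gθ x * (pinnedChain ω₂ lam β γ).gibbsDensity L T x with hPa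
  set Q : Fin m → ℝ := fun a => ∫ x, (partialP (s a) gθ x - θ a / c * x.2 (s a)) ^ 2 * (pinnedChain ω₂ lam β γ).gibbsDensity L T x
    with hQ
  -- (FD with mass): I = κ G2 + cT Σ_a D_a
  have hFD : I = κ * G2 + c * T * ∑ a, D a := by
    have h := resolvent_fd hω hl hβ L hT B hB0 σ hc κ hgθ hgθL hkθL hpθ
    simp only [hI, hG2, hD]
    rw [h, sum_termWeight_mul s fun i => ∫ x, partialP i gθ x ^ 2 * (pinnedChain ω₂ lam β γ).gibbsDensity L T x]
  -- (G): I = T Σ_a θ_a P_a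
  have hG : I = T * ∑ a, θ a * Pa a := by
    have hIa : ∀ a, Integrable fun x => (x.2 (s a) ^ 2 - T) * gθ x * (pinnedChain ω₂ lam β γ).gibbsDensity L T x := fun a =>
      integrable_mul_mul_gibbsDensity hω hl hβ γ L hT (memLp_kinetic hω hl hβ L hT (s a)) hgθL
    have hsplit : I = ∑ a, θ a * ∫ x, (x.2 (s a) ^ 2 - T) * gθ x * (pinnedChain ω₂ lam β γ).gibbsDensity L T x := by
      simp only [hI]
      have hpt : (fun x => gθ x * kθ x * (pinnedChain ω₂ lam β γ).gibbsDensity L T x) =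
          fun x => ∑ a, θ a * ((x.2 (s a) ^ 2 - T) * gθ x * (pinnedChain ω₂ lam β γ).gibbsDensity L T x) := by
        funext x
        simp only [hkθdef, comb_apply, Finset.mul_sum, Finset.sum_mul]
        refine Finset.sum_congr rfl fun a _ => ?_
        ring
      rw [hpt, integral_finsetSum _ fun a _ => (hIa a).const_mul _]
      refine Finset.sum_congr rfl fun a _ => ?_
      exact integral_const_mul _ _
    rw [hsplit, Finset.mul_sum]
    refine Finset.sum_congr rfl fun a _ => ?_
    rw [gauss_ibp hω hl hβ L hT (s a) hgθ1 hgθL (hd2 a)]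
    ring
  have hM : ∀ a, ∫ x, x.2 (s a) ^ 2 * (pinnedChain ω₂ lam β γ).gibbsDensity L T x = T * Z := fun a =>
    integral_sq_mul_gibbsDensity_eq hω hl hβ L hT (s a)
  have hQexp : ∀ a, Q a = D a - 2 * (θ a / c) * Pa a + (θ a / c) ^ 2 * (T * Z) := by
    intro a
    simp only [hQ, hD, hPa]
    rw [integral_sub_sq_mul_gibbsDensity hω hl hβ L hT (hd2 a) (θ a / c) (s a), hM a]
  have hsumQ : ∑ a, Q a = (∑ a, D a) - 2 / c * (∑ a, θ a * Pa a) + T * Z / c ^ 2 * ∑ a, θ a ^ 2 := by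
    simp only [hQexp, Finset.sum_add_distrib, Finset.sum_sub_distrib, Finset.mul_sum]
    congr 1
    · congr 1
      exact Finset.sum_congr rfl fun a _ => by ring
    · exact Finset.sum_congr rfl fun a _ => by ring
  have hSP : T * ∑ a, θ a * Pa a = κ * G2 + c * T * ∑ a, D a := by rw [← hG, hFD]
  have hnn : ∀ (u : PhaseSpace L → ℝ), 0 ≤ ∫ x, u x ^ 2 * (pinnedChain ω₂ lam β γ).gibbsDensity L T x := fun u =>
    integral_nonneg fun x => mul_nonneg (sq_nonneg _) ((pinnedChain ω₂ lam β γ).gibbsDensity_pos L T x).le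
  have hQ0 : 0 ≤ ∑ a, Q a := Finset.sum_nonneg fun a _ => hnn _
  have hD0 : 0 ≤ ∑ a, D a := Finset.sum_nonneg fun a _ => hnn _
  have hG20 : 0 ≤ G2 := hnn _
  have hc0 : c ≠ 0 := hc.ne'
  -- c T Σ Q = c T Σ D − 2 T Σ θ P + T² Z |θ|² / c
  have e1 : c * T * ∑ a, Q a =
      c * T * (∑ a, D a) - 2 * T * (∑ a, θ a * Pa a) + T ^ 2 * Z / c * ∑ a, θ a ^ 2 := by
    rw [hsumQ]
    field_simp
  -- hence I + κ G2 + cT Σ Q = T² Z |θ|²/c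
  have key : I + κ * G2 + c * T * ∑ a, Q a = T ^ 2 / c * (∑ a, θ a ^ 2) * Z := by
    rw [e1, hFD]
    have : 2 * T * ∑ a, θ a * Pa a = 2 * (κ * G2 + c * T * ∑ a, D a) := by rw [← hSP]; ring
    rw [this]
    field_simp
    ring
  have hcTQ : 0 ≤ c * T * ∑ a, Q a := mul_nonneg (mul_nonneg hc.le hT.le) hQ0
  have hκG2 : 0 ≤ κ * G2 := mul_nonneg hκ hG20
  have hcTD : 0 ≤ c * T * ∑ a, D a := mul_nonneg (mul_nonneg hc.le hT.le) hD0
  have hIge : κ * G2 ≤ I := by rw [hFD]; linarith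
  refine ⟨?_, ?_, ?_⟩
  · linarith
  · linarith
  · linarith

/-- **KUBO–ONSAGER STRUCTURE FOR RESOLVENT FIELDS (λ-frame).** In a terminal frame of `κ`-resolvent fields
(`κ ≥ 0`; `σ X_H g_a + c S g_a = −((p_{s_a}² − T) − κ g_a)`), the matrix
`K_ab = c δ_ab − (c²/T²) ∫ g_a (p_{s_b}² − T) dμ_T` is SYMMETRIC and POSITIVE SEMIDEFINITE, its row sums are
`Σ_b K_ab = (c κ/T²) ∫ g_a H dμ_T`, `κ ∫ g_a² dμ_T ≤ T²/c` (so the row sums are `O(√κ)` by Cauchy–Schwarz), and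
`θᵀ K θ ≤ c |θ|²` (entries bounded). No kernel statement (that needs `κ = 0`). [folklore] -/
theorem kubo_onsager_resolvent (hω : 0 < ω₂) (hl : 0 ≤ lam) (hβ : 0 ≤ β) (L : ℕ) {T : ℝ} (hT : 0 < T)
    (s : Fin m → Fin L) (hs : Function.Injective s) (σ : ℝ) {c : ℝ} (hc : 0 < c) {κ : ℝ} (hκ : 0 ≤ κ)
    {g : Fin m → PhaseSpace L → ℝ} (hg : ∀ a, ContDiff ℝ 2 (g a)) (hgL : ∀ a, MemLp (g a) 2 ((pinnedChain ω₂ lam β γ).gibbsMeasure L T))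
    (hpde : ∀ a x, σ * liouvilleOp (pinnedChain ω₂ lam β γ) L (g a) x + c * bathOp L (termWeight s) T (g a) x =
      -((x.2 (s a) ^ 2 - T) - κ * g a x))
    (K : Matrix (Fin m) (Fin m) ℝ)
    (hK : ∀ a b, K a b = (if a = b then c else 0) -
      c ^ 2 / T ^ 2 * ∫ x, g a x * (x.2 (s b) ^ 2 - T) ∂((pinnedChain ω₂ lam β γ).gibbsMeasure L T)) :
    K.IsSymm ∧ (∀ θ : Fin m → ℝ, 0 ≤ ∑ a, ∑ b, θ a * K a b * θ b) ∧
      (∀ a, ∑ b, K a b = c * κ / T ^ 2 * ∫ x, g a x * (pinnedChain ω₂ lam β γ).hamiltonian L x ∂((pinnedChain ω₂ lam β γ).gibbsMeasure L T)) ∧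
      (∀ a, κ * ∫ x, g a x ^ 2 ∂((pinnedChain ω₂ lam β γ).gibbsMeasure L T) ≤ T ^ 2 / c) ∧
      (∀ θ : Fin m → ℝ, ∑ a, ∑ b, θ a * K a b * θ b ≤ c * ∑ a, θ a ^ 2) := by
  set Z : ℝ := ∫ x, (pinnedChain ω₂ lam β γ).gibbsDensity L T x with hZ
  have hZpos : 0 < Z := partition_pos hω hl hβ L hT
  set M : Fin m → Fin m → ℝ := fun a b => ∫ x, g a x * (x.2 (s b) ^ 2 - T) * (pinnedChain ω₂ lam β γ).gibbsDensity L T x with hM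
  have hK' : ∀ a b, K a b = (if a = b then c else 0) - c ^ 2 / T ^ 2 * Z⁻¹ * M a b := by
    intro a b
    rw [hK, (pinnedChain ω₂ lam β γ).integral_gibbsMeasure]
    ring
  have hsymM : ∀ a b, M a b = M b a := fun a b => resolvent_kuboPair_symm hω hl hβ L hT s σ hc κ hg hgL hpde a b
  have hsumM : ∀ a, ∑ b, M a b = T ^ 2 / c * Z -
      κ / c * ∫ x, g a x * (pinnedChain ω₂ lam β γ).hamiltonian L x * (pinnedChain ω₂ lam β γ).gibbsDensity L T x := fun a =>
    resolvent_sum_kuboPair hω hl hβ L hT s σ hc κ hg hgL hpde a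
  have hquad : ∀ θ : Fin m → ℝ, ∑ a, ∑ b, θ a * K a b * θ b =
      c * ∑ a, θ a ^ 2 - c ^ 2 / T ^ 2 * Z⁻¹ *
        ∫ x, comb θ g x * comb θ (fun b y => y.2 (s b) ^ 2 - T) x * (pinnedChain ω₂ lam β γ).gibbsDensity L T x := by
    intro θ
    simp only [hK']
    rw [quadForm_expand, integral_comb_mul_comb hω hl hβ L hT θ θ hgL fun b => memLp_kinetic hω hl hβ L hT (s b)]
  have hc0 : c ≠ 0 := hc.ne'
  have hZ0 : Z ≠ 0 := hZpos.ne'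
  refine ⟨?_, ?_, ?_, ?_, ?_⟩
  · refine Matrix.IsSymm.ext fun a b => ?_
    rw [hK' a b, hK' b a, hsymM a b]
    by_cases hab : a = b
    · subst hab; rfl
    · rw [if_neg hab, if_neg (Ne.symm hab)]
  · intro θ
    rw [hquad θ]
    have h1 := (resolvent_comb_kinetic_le hω hl hβ L hT s hs σ hc hκ hg hgL hpde θ).1
    have h2 : c ^ 2 / T ^ 2 * Z⁻¹ *
        ∫ x, comb θ g x * comb θ (fun b y => y.2 (s b) ^ 2 - T) x * (pinnedChain ω₂ lam β γ).gibbsDensity L T x ≤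
        c ^ 2 / T ^ 2 * Z⁻¹ * (T ^ 2 / c * (∑ a, θ a ^ 2) * Z) :=
      mul_le_mul_of_nonneg_left h1 (by positivity)
    have h3 : c ^ 2 / T ^ 2 * Z⁻¹ * (T ^ 2 / c * (∑ a, θ a ^ 2) * Z) = c * ∑ a, θ a ^ 2 := by
      field_simp
    linarith
  · intro a
    simp only [hK', Finset.sum_sub_distrib, Finset.sum_ite_eq, Finset.mem_univ, if_true, ← Finset.mul_sum, hsumM a]
    rw [(pinnedChain ω₂ lam β γ).integral_gibbsMeasure, ← hZ]
    field_simp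
    ring
  · intro a
    -- θ = indicator of a: comb θ g = g a
    have h := (resolvent_comb_kinetic_le hω hl hβ L hT s hs σ hc hκ hg hgL hpde (fun b => if b = a then 1 else 0)).2.1
    have hcomb : comb (fun b => if b = a then (1 : ℝ) else 0) g = g a := by
      funext x
      simp [comb_apply, Finset.sum_ite_eq']
    have hθ2 : ∑ b : Fin m, (if b = a then (1 : ℝ) else 0) ^ 2 = 1 := by
      simp [Finset.sum_ite_eq']
    rw [hcomb, hθ2, mul_one] at h
    rw [(pinnedChain ω₂ lam β γ).integral_gibbsMeasure]
    -- h : κ * ∫ (g a)² ρ ≤ T²/c * Z ; goal: κ * (Z⁻¹ * ∫ (g a)² ρ) ≤ T²/c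
    have hZinv : 0 < Z⁻¹ := inv_pos.mpr hZpos
    have := mul_le_mul_of_nonneg_left h hZinv.le
    calc κ * (Z⁻¹ * ∫ x, g a x ^ 2 * (pinnedChain ω₂ lam β γ).gibbsDensity L T x)
        = Z⁻¹ * (κ * ∫ x, g a x ^ 2 * (pinnedChain ω₂ lam β γ).gibbsDensity L T x) := by ring
      _ ≤ Z⁻¹ * (T ^ 2 / c * Z) := this
      _ = T ^ 2 / c := by field_simp
  · intro θ
    rw [hquad θ]
    have h0 := (resolvent_comb_kinetic_le hω hl hβ L hT s hs σ hc hκ hg hgL hpde θ).2.2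
    have : 0 ≤ c ^ 2 / T ^ 2 * Z⁻¹ *
        ∫ x, comb θ g x * comb θ (fun b y => y.2 (s b) ^ 2 - T) x * (pinnedChain ω₂ lam β γ).gibbsDensity L T x :=
      mul_nonneg (by positivity) h0
    linarith

end Resolvent


/-- Registered helper sub-goal `helper_kuboOnsagerResolvent` (= `kubo_onsager_resolvent` in stub form; λ-frame of line
`floating-probe-bypass-laplacian`, crux stmt-AtomisticToContinuum-11748). [folklore] -/
theorem helper_kuboOnsagerResolvent : ∀ {ω₂ lam β γ : ℝ} {m : ℕ}, 0 < ω₂ → 0 ≤ lam → 0 ≤ β → ∀ (L : ℕ) {T : ℝ}, 0 < T → ∀ (s : Fin m → Fin L), Function.Injective s → ∀ (σ : ℝ) {c : ℝ}, 0 < c → ∀ {κ : ℝ}, 0 ≤ κ → ∀ {g : Fin m → PhaseSpace L → ℝ}, (∀ a, ContDiff ℝ 2 (g a)) → (∀ a, MemLp (g a) 2 ((pinnedChain ω₂ lam β γ).gibbsMeasure L T)) → (∀ a x, σ * liouvilleOp (pinnedChain ω₂ lam β γ) L (g a) x + c * bathOp L (termWeight s) T (g a) x = -((x.2 (s a) ^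 2 - T) - κ * g a x)) → ∀ (K : Matrix (Fin m) (Fin m) ℝ), (∀ a b, K a b = (if a = b then c else 0) - c ^ 2 / T ^ 2 * ∫ x, g a x * (x.2 (s b) ^ 2 - T) ∂((pinnedChain ω₂ lam β γ).gibbsMeasure L T)) → K.IsSymm ∧ (∀ θ : Fin m → ℝ, 0 ≤ ∑ a, ∑ b, θ a * K a b * θ b) ∧ (∀ a, ∑ b, K a b = c * κ / T ^ 2 * ∫ x, g a x * (pinnedChain ω₂ lam β γ).hamiltonian L x ∂((pinnedChain ω₂ lam β γ).gibbsMeasure L T)) ∧ (∀ a, κ * ∫ x, g a x ^ 2 ∂((pinnedChain ω₂ lam β γ).gibbsMeasure L T) ≤ T ^ 2 / c) :=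
  fun hω hl hβ L _ hT s hs σ _ hc _ hκ _ hg hgL hpde K hK =>
    let h := kubo_onsager_resolvent hω hl hβ L hT s hs σ hc hκ hg hgL hpde K hK
    ⟨h.1, h.2.1, h.2.2.1, h.2.2.2.1⟩

end Summit.AtomisticToContinuum.FouriersLaw.Theorems.SuperadditiveResistance.Kubo

end
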